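import Literature.MathematicalPhysics.QuantumFieldTheory.Balaban1983to89.B13DirichletLocalRProjLetters
import Literature.MathematicalPhysics.QuantumFieldTheory.Balaban1983to89.B13OpsYPencilXQuad
import Literature.MathematicalPhysics.QuantumFieldTheory.Balaban1983to89.B13EntryLetterAlgebraFamily

/-!
# `Balaban1983to89.B13DirichletLocalXLetters` — T. Bałaban, *Propagators for lattice gauge theories in a background field*, Commun. Math. Phys. **99** (1985) 389–434
# [Balaban1985BackgroundPropagators], (3.19)–(3.21) pp. 393–394, (3.24)–(3.25) pp. 394–395, Thm 3.4 p. 400, Sect. B (3.66)–(3.68) p. 403, (3.69)–(3.70) p. 404, Sect. C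
# pp. 408–409 («G′_□(U), C_□(U) = (Q′(U)G′_□²(U)Q′*(U))⁻¹»), (3.87) p. 409, Thm 3.10 (3.107)–(3.108) p. 416; [Balaban1988RG2Cluster] (2.5)–(2.7) pp. 12–13, p. 15 (the
# complexified configuration `U = U′U₀`); [Balaban1984PropagatorsII] (2.54) p. 232, Lemma 2.1 (2.61) p. 234:
# ★★ THE X-STATION ALONG ANY HOLOMORPHIC BACKGROUND FAMILY — `X(F u) = Q′(F u)·G′(F u)²·Q′*(F u)` for ANY site transporter `parS`, ANY site letter `Gp` (the local
# `G′_□ = GsqY i parS D` of Sect. C included) and ANY holomorphic family `F : E → CfgY` (dag-n10-w2's `B13OpsYPencilXQuadGen` §1–§2 with `prodCfg U₀ η a ↦ F u`; the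
# transporter facts along `F` by dag-n10-w6 g4's `B13DirichletLocalRProjLetters` §1) — the `X_□` half of station L2 of the local-cube road (dag-n10-w3 g5's design
# I.38011: stations generic in the chart and the background family; lane fan-out I.38258).

[folklore] bookkeeping over cited tree theorems BY NAME; THEOREMS ONLY (no `def`, no `structure`, no instance, no notation); NODE 00's `QpY ∕ QpsY ∕ qpT ∕ qpK ∕ qpsK ∕ XY ∕
GsqY` CONSUMED BY NAME, nothing of `Node00/OpsY*` modified; nothing here is a claim about the Yang–Mills mass gap; no node is discharged; count-neutral.

WHAT THIS FILE PROVES (all `theorem`s; `B_S ∕ B_B` = the `b`-product bases over sites ∕ blocks, `b` any basis of `𝔸` with numerals `cb, cl`).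
* `rowSum_site_toMatrix_QpY_le_of_family` ∕ `colSum_site_toMatrix_QpsY_le_of_family` — the site-indexed sums of w2's XQuadGen §1 along a family `F` (one transporter
  numeral `KQ` on the supports of `qpK ∕ qpsK`, kernel sums `CQ ∕ CQs`), from w6's `norm_toMatrix_QpY_le_of_family ∕ …QpsY…`.
* ★★ `rawEntryLetters_toMatrix_XY_of_family`: `Gp`'s letters along `F` on sites `(Rc, ρ, B_G′)` (DISPLAYED — at `Gp := GsqY i parS D` it is L1's OUTPUT ∕ w6's `hG`
  verbatim), a fibre bound `m_S`, a rate loss `0 < μ ≤ ρ`, the transporter facts `hQh hQhi hQf hQb hQsf hQsb`, readings `ℓS, ℓB` with range numeral `r` ⟹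
  `RawEntryLetters (u ↦ toMatrix B_B B_B (X(F u))) (ℓB ∘ fst) Rc (ρ − μ) (a·b·(B_G′²·(m_S·c₀(1,μ)^ν))·e^{2(ρ−μ)r})` — (D′) sandwich of the product `G′·G′` (34).
HONEST FRAMING: readers + sandwiches over cited tree theorems; `Gp`'s letters and the transporter facts are DISPLAYED; nothing of Bałaban's asserted; N06 ∕ N10 NOT
discharged; K1⁹ NOT closed; counts unmoved (typed 28∕28 · discharged 5∕27); 0 `def`, 0 `sorry`, standard axioms; one finite 𝕋⁴ programme at fixed ε — R4 closes the
conditional finite-𝕋⁴ rung `BalabanLadder.UV` only; the YM mass gap (Clay) is NOT proved by any of this; nothing continuum ∕ ℝ⁴ ∕ OS.  Filed `--kind proof --supports`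
K1⁹ (stmt-QuantumFields-27364), Literature lane.
-/

noncomputable section

namespace Literature.MathematicalPhysics.QuantumFieldTheory.Balaban1983to89.B13DirichletLocalXLetters

open Metric Set Finset Module
open scoped Matrix
open Literature.MathematicalPhysics.QuantumFieldTheory.Balaban1983to89
open Literature.MathematicalPhysics.QuantumFieldTheory.Balaban1983to89.B9Thm37GlueTorus (tdist1)
open Literature.MathematicalPhysics.QuantumFieldTheory.Balaban1983to89.B5TorusCover (UT)
open Literature.MathematicalPhysics.QuantumFieldTheory.Balaban1983to89.B13EntrywiseWalks (RawEntryLetters)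
open Literature.MathematicalPhysics.QuantumFieldTheory.Balaban1983to89.B13EntryLetterAlgebra (rawEntryLetters_congr rawEntryLetters_mul_torus)
open Literature.MathematicalPhysics.QuantumFieldTheory.Balaban1983to89.B13EntryLetterAlgebraFamily (rawEntryLetters_sandwich_family)
open Literature.MathematicalPhysics.QuantumFieldTheory.Balaban1983to89.B13OpsYPencilXQuad (toMatrix_XY_eq tdist_le_of_toMatrix_QpY_ne_zero tdist_le_of_toMatrix_QpsY_ne_zero)
open Literature.MathematicalPhysics.QuantumFieldTheory.Balaban1983to89.B13DirichletLocalRProjLetters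
  (differentiableOn_toMatrix_QpY_of_family differentiableOn_toMatrix_QpsY_of_family norm_toMatrix_QpY_le_of_family norm_toMatrix_QpsY_le_of_family)
open Literature.MathematicalPhysics.QuantumFieldTheory.Balaban1983to89.B6GlobalChartV1 (PV boxEquiv)
open Literature.MathematicalPhysics.QuantumFieldTheory.Balaban1983to89.B6KLevelCensusIndexV1 (KIdx)
open Literature.MathematicalPhysics.QuantumFieldTheory.Balaban1983to89.Node00

/-! ## §1. Site-indexed sums of the `Q′ ∕ Q′*` matrices along a family -/

section XStation

variable {𝔸 : Type} [NormedRing 𝔸] [NormedAlgebra ℂ 𝔸] [CompleteSpace 𝔸]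
variable {d ℓ : ℕ} {hd : 1 ≤ d + 1} {hL : Odd (ℓ + 1) ∧ 1 < ℓ + 1} {b₀ b₁ : ℝ}
variable (i : KIdx d ℓ hd hL b₀ b₁)
variable {κ : Type} [Fintype κ] [DecidableEq κ] (b : Basis κ ℂ 𝔸)
variable (parS : SiteParY 𝔸 i) {E : Type*} [NormedAddCommGroup E] [NormedSpace ℂ E] (F : E → CfgY 𝔸 i) {Rc KQ : ℝ}
variable [DecidableEq (SiteY i)] [DecidableEq (BlkY i)]
variable {ν : ℕ} {Nf : Fin ν → ℕ} [∀ j, NeZero (Nf j)]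

omit [NormedSpace ℂ E] [DecidableEq (BlkY i)] in
/-- `Q′` along ANY family `F`, ANY `parS`: ROW SUMS over the site index `Σ_{(z,l)} ‖toMatrix(Q′)(s,k)(z,l)‖ ≤ CQ·|κ|·(cb·(KQ·cl·KQ))`, numeral `CQ ≥ Σ_z |qpK(s,z)|`
(XQuadGen §1 with `prodCfg U₀ η a ↦ F u`). [cite: Balaban1985BackgroundPropagators, (3.19) p.393; Balaban1984PropagatorsII, (2.54) p.232] -/
theorem rowSum_site_toMatrix_QpY_le_of_family {cb cl : ℝ} (hcb : ∀ (x : 𝔸) (k : κ), ‖b.repr x k‖ ≤ cb * ‖x‖) (hcb0 : 0 ≤ cb) (hcl : ∀ l, ‖b l‖ ≤ cl)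
    (hcl0 : 0 ≤ cl) (hKQ : 0 ≤ KQ)
    (hQf : ∀ u ∈ ball (0 : E) Rc, ∀ s z, qpK i s z ≠ 0 → ‖(qpT i parS (F u) s z : 𝔸)‖ ≤ KQ)
    (hQb : ∀ u ∈ ball (0 : E) Rc, ∀ s z, qpK i s z ≠ 0 → ‖(((qpT i parS (F u) s z)⁻¹ : 𝔸ˣ) : 𝔸)‖ ≤ KQ)
    {CQ : ℝ} (hCQ : ∀ s, ∑ z, |qpK i s z| ≤ CQ)
    {u : E} (hu : u ∈ ball (0 : E) Rc) (p : BlkY i × κ) :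
    ∑ q : SiteY i × κ, ‖LinearMap.toMatrix ((Pi.basis fun _ : SiteY i => b).reindex (Equiv.sigmaEquivProd (SiteY i) κ))
      ((Pi.basis fun _ : BlkY i => b).reindex (Equiv.sigmaEquivProd (BlkY i) κ)) (QpY i parS (F u)) p q‖ ≤ CQ * (Fintype.card κ : ℝ) * (cb * (KQ * cl * KQ)) := by
  set c : ℝ := cb * (KQ * cl * KQ) with hc
  have hc0 : 0 ≤ c := mul_nonneg hcb0 (mul_nonneg (mul_nonneg hKQ hcl0) hKQ)
  calc ∑ q : SiteY i × κ, ‖LinearMap.toMatrix ((Pi.basis fun _ : SiteY i => b).reindex (Equiv.sigmaEquivProd (SiteY i) κ))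
          ((Pi.basis fun _ : BlkY i => b).reindex (Equiv.sigmaEquivProd (BlkY i) κ)) (QpY i parS (F u)) p q‖
      ≤ ∑ q : SiteY i × κ, |qpK i p.1 q.1| * c :=
        Finset.sum_le_sum fun q _ => norm_toMatrix_QpY_le_of_family i b parS F hcb hcb0 hcl hKQ hQf hQb hu p q
    _ = (∑ z : SiteY i, |qpK i p.1 z|) * (Fintype.card κ : ℝ) * c := by
        rw [Fintype.sum_prod_type, Finset.sum_mul, Finset.sum_mul]
        refine Finset.sum_congr rfl fun z _ => ?_
        show ∑ _y : κ, |qpK i p.1 z| * c = _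
        rw [Finset.sum_const, Finset.card_univ, nsmul_eq_mul]
        ring
    _ ≤ CQ * (Fintype.card κ : ℝ) * c :=
        mul_le_mul_of_nonneg_right (mul_le_mul_of_nonneg_right (hCQ p.1) (Nat.cast_nonneg _)) hc0

omit [NormedSpace ℂ E] [DecidableEq (SiteY i)] in
/-- `Q′*` along ANY family `F`, ANY `parS`: COLUMN SUMS over the site index `Σ_{(z,l)} ‖toMatrix(Q′*)(z,l)(s,k)‖ ≤ CQs·|κ|·(cb·(KQ·cl·KQ))`, numeral `CQs ≥ Σ_z |qpsK(z,s)|`.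
[cite: Balaban1985BackgroundPropagators, (3.24) p.394; Balaban1984PropagatorsII, (2.54) p.232] -/
theorem colSum_site_toMatrix_QpsY_le_of_family {cb cl : ℝ} (hcb : ∀ (x : 𝔸) (k : κ), ‖b.repr x k‖ ≤ cb * ‖x‖) (hcb0 : 0 ≤ cb) (hcl : ∀ l, ‖b l‖ ≤ cl)
    (hcl0 : 0 ≤ cl) (hKQ : 0 ≤ KQ)
    (hQsf : ∀ u ∈ ball (0 : E) Rc, ∀ z s, qpsK i z s ≠ 0 → ‖(((qpT i parS (F u) s z)⁻¹ : 𝔸ˣ) : 𝔸)‖ ≤ KQ)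
    (hQsb : ∀ u ∈ ball (0 : E) Rc, ∀ z s, qpsK i z s ≠ 0 → ‖(qpT i parS (F u) s z : 𝔸)‖ ≤ KQ)
    {CQs : ℝ} (hCQs : ∀ s, ∑ z, |qpsK i z s| ≤ CQs)
    {u : E} (hu : u ∈ ball (0 : E) Rc) (p : BlkY i × κ) :
    ∑ q : SiteY i × κ, ‖LinearMap.toMatrix ((Pi.basis fun _ : BlkY i => b).reindex (Equiv.sigmaEquivProd (BlkY i) κ))
      ((Pi.basis fun _ : SiteY i => b).reindex (Equiv.sigmaEquivProd (SiteY i) κ)) (QpsY i parS (F u)) q p‖ ≤ CQs * (Fintype.card κ : ℝ) * (cb * (KQ * cl * KQ)) := by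
  set c : ℝ := cb * (KQ * cl * KQ) with hc
  have hc0 : 0 ≤ c := mul_nonneg hcb0 (mul_nonneg (mul_nonneg hKQ hcl0) hKQ)
  calc ∑ q : SiteY i × κ, ‖LinearMap.toMatrix ((Pi.basis fun _ : BlkY i => b).reindex (Equiv.sigmaEquivProd (BlkY i) κ))
          ((Pi.basis fun _ : SiteY i => b).reindex (Equiv.sigmaEquivProd (SiteY i) κ)) (QpsY i parS (F u)) q p‖
      ≤ ∑ q : SiteY i × κ, |qpsK i q.1 p.1| * c :=
        Finset.sum_le_sum fun q _ => norm_toMatrix_QpsY_le_of_family i b parS F hcb hcb0 hcl hKQ hQsf hQsb hu q p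
    _ = (∑ z : SiteY i, |qpsK i z p.1|) * (Fintype.card κ : ℝ) * c := by
        rw [Fintype.sum_prod_type, Finset.sum_mul, Finset.sum_mul]
        refine Finset.sum_congr rfl fun z _ => ?_
        show ∑ _y : κ, |qpsK i z p.1| * c = _
        rw [Finset.sum_const, Finset.card_univ, nsmul_eq_mul]
        ring
    _ ≤ CQs * (Fintype.card κ : ℝ) * c :=
        mul_le_mul_of_nonneg_right (mul_le_mul_of_nonneg_right (hCQs p.1) (Nat.cast_nonneg _)) hc0

/-! ## §2. ★★ `X = Q′G′²Q′*` along ANY holomorphic background family -/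

/-- ★★ **THE X-STATION ALONG ANY HOLOMORPHIC BACKGROUND FAMILY** (`X(F u) = Q′(F u)·G′(F u)²·Q′*(F u)`, ANY `parS`, ANY site letter `Gp`): from `Gp`'s letters along
`F` on sites `(Rc, ρ, B_G′)` (displayed — at `Gp := GsqY i parS D` it is L1's OUTPUT ∕ w6's `hG`), a fibre bound `m_S`, a rate loss `0 < μ ≤ ρ`, the transporter facts
`hQh hQhi hQf hQb hQsf hQsb` of `u ↦ qpT i parS (F u)` with numeral `KQ ≥ 0`, kernel sums `CQ, CQs ≥ 0`, readings `ℓS, ℓB` with range numeral `r`: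
`RawEntryLetters (u ↦ toMatrix B_B B_B (X(F u))) (ℓB ∘ fst) Rc (ρ − μ) (a·b·(B_G′²·(m_S·c₀(1,μ)^ν))·e^{2(ρ−μ)r})` — w2's XQuadGen §2, `prodCfg U₀ η a ↦ F u`.
[cite: Balaban1985BackgroundPropagators, (3.25) p.394, (3.87) p.409 (Q′G′_□²Q′*), Thm 3.4 p.400, (3.66)–(3.68) p.403, (3.69)–(3.70) p.404, Thm 3.10 (3.108) p.416;
Balaban1988RG2Cluster, (2.5)–(2.6) p.12, p.15; Balaban1984PropagatorsII, (2.54) p.232, Lemma 2.1 (2.61) p.234] -/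
theorem rawEntryLetters_toMatrix_XY_of_family (Gp : SiteOpY 𝔸 i) {cb cl : ℝ}
    (hcb : ∀ (x : 𝔸) (k : κ), ‖b.repr x k‖ ≤ cb * ‖x‖) (hcb0 : 0 ≤ cb) (hcl : ∀ l, ‖b l‖ ≤ cl) (hcl0 : 0 ≤ cl) (hKQ : 0 ≤ KQ)
    (hQh : ∀ s z, DifferentiableOn ℂ (fun u : E => (qpT i parS (F u) s z : 𝔸)) (ball (0 : E) Rc))
    (hQhi : ∀ s z, DifferentiableOn ℂ (fun u : E => (((qpT i parS (F u) s z)⁻¹ : 𝔸ˣ) : 𝔸)) (ball (0 : E) Rc))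
    (hQf : ∀ u ∈ ball (0 : E) Rc, ∀ s z, qpK i s z ≠ 0 → ‖(qpT i parS (F u) s z : 𝔸)‖ ≤ KQ)
    (hQb : ∀ u ∈ ball (0 : E) Rc, ∀ s z, qpK i s z ≠ 0 → ‖(((qpT i parS (F u) s z)⁻¹ : 𝔸ˣ) : 𝔸)‖ ≤ KQ)
    (hQsf : ∀ u ∈ ball (0 : E) Rc, ∀ z s, qpsK i z s ≠ 0 → ‖(((qpT i parS (F u) s z)⁻¹ : 𝔸ˣ) : 𝔸)‖ ≤ KQ)
    (hQsb : ∀ u ∈ ball (0 : E) Rc, ∀ z s, qpsK i z s ≠ 0 → ‖(qpT i parS (F u) s z : 𝔸)‖ ≤ KQ)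
    {CQ CQs : ℝ} (hCQ0 : 0 ≤ CQ) (hCQ : ∀ s, ∑ z, |qpK i s z| ≤ CQ) (hCQs0 : 0 ≤ CQs) (hCQs : ∀ s, ∑ z, |qpsK i z s| ≤ CQs)
    (ℓS : SiteY i → UT Nf) (ℓB : BlkY i → UT Nf) {r : ℝ}
    (hℓQ : ∀ s z, qpK i s z ≠ 0 → tdist1 Nf (ℓB s) (ℓS z) ≤ r) (hℓQs : ∀ z s, qpsK i z s ≠ 0 → tdist1 Nf (ℓS z) (ℓB s) ≤ r)
    {mS : ℕ} (hfibS : ∀ y : UT Nf, (univ.filter fun q : SiteY i × κ => ℓS q.1 = y).card ≤ mS)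
    {ρ BG μ : ℝ}
    (hG : RawEntryLetters (fun u : E =>
      LinearMap.toMatrix ((Pi.basis fun _ : SiteY i => b).reindex (Equiv.sigmaEquivProd (SiteY i) κ))
        ((Pi.basis fun _ : SiteY i => b).reindex (Equiv.sigmaEquivProd (SiteY i) κ)) (Gp (F u)))
      (fun q : SiteY i × κ => ℓS q.1) Rc ρ BG)
    (hμ : 0 < μ) (hμρ : μ ≤ ρ) :
    RawEntryLetters (fun u : E =>
        LinearMap.toMatrix ((Pi.basis fun _ : BlkY i => b).reindex (Equiv.sigmaEquivProd (BlkY i) κ))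
          ((Pi.basis fun _ : BlkY i => b).reindex (Equiv.sigmaEquivProd (BlkY i) κ)) (XY i parS Gp (F u)))
      (fun p : BlkY i × κ => ℓB p.1) Rc (ρ - μ)
      (CQ * (Fintype.card κ : ℝ) * (cb * (KQ * cl * KQ)) * (CQs * (Fintype.card κ : ℝ) * (cb * (KQ * cl * KQ))) *
        (BG * BG * (mS * B6.c0 1 μ ^ ν)) * Real.exp (2 * (ρ - μ) * r)) := by
  have hG2 := rawEntryLetters_mul_torus hG hG hμ (κ := ρ - μ) (by linarith) (by linarith) (by linarith) hfibS
  have hc0 : 0 ≤ cb * (KQ * cl * KQ) := mul_nonneg hcb0 (mul_nonneg (mul_nonneg hKQ hcl0) hKQ)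
  have ha0 : 0 ≤ CQ * (Fintype.card κ : ℝ) * (cb * (KQ * cl * KQ)) := mul_nonneg (mul_nonneg hCQ0 (Nat.cast_nonneg _)) hc0
  have hb0 : 0 ≤ CQs * (Fintype.card κ : ℝ) * (cb * (KQ * cl * KQ)) := mul_nonneg (mul_nonneg hCQs0 (Nat.cast_nonneg _)) hc0
  have hS := rawEntryLetters_sandwich_family (locp := fun p : BlkY i × κ => ℓB p.1) hG2 (by linarith)
    (A := fun u => LinearMap.toMatrix ((Pi.basis fun _ : SiteY i => b).reindex (Equiv.sigmaEquivProd (SiteY i) κ))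
        ((Pi.basis fun _ : BlkY i => b).reindex (Equiv.sigmaEquivProd (BlkY i) κ)) (QpY i parS (F u)))
    (B' := fun u => LinearMap.toMatrix ((Pi.basis fun _ : BlkY i => b).reindex (Equiv.sigmaEquivProd (BlkY i) κ))
        ((Pi.basis fun _ : SiteY i => b).reindex (Equiv.sigmaEquivProd (SiteY i) κ)) (QpsY i parS (F u)))
    (r := r) ha0 hb0
    (fun p q => differentiableOn_toMatrix_QpY_of_family i b parS F hcb hQh hQhi p q)
    (fun u _ p q hne => tdist_le_of_toMatrix_QpY_ne_zero i b ℓS ℓB hℓQ parS (F u) p q hne)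
    (fun u hu p => rowSum_site_toMatrix_QpY_le_of_family i b parS F hcb hcb0 hcl hcl0 hKQ hQf hQb hCQ hu p)
    (fun q p => differentiableOn_toMatrix_QpsY_of_family i b parS F hcb hQh hQhi q p)
    (fun u _ q p hne => tdist_le_of_toMatrix_QpsY_ne_zero i b ℓS ℓB hℓQs parS (F u) q p hne)
    (fun u hu p => colSum_site_toMatrix_QpsY_le_of_family i b parS F hcb hcb0 hcl hcl0 hKQ hQsf hQsb hCQs hu p)
  refine rawEntryLetters_congr hS fun u _ => ?_
  rw [toMatrix_XY_eq]

end XStation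

end Literature.MathematicalPhysics.QuantumFieldTheory.Balaban1983to89.B13DirichletLocalXLetters

end
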